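import Mathlib

/-!
# Discrete radial geometry of a lattice cell (toolkit for the stub `stub_innerWindowGaugeSmall` of
# `BackwardLiouvilleRigidity.FlatRatioTermination`, stmt-QuantumFields-22542)

A CELL of the cubical complex of side `R = 2m` in `ℤ^d`: lower corner `lo`, active directions `D ⊆ Fin d`, the integer box
`B = [lo, hi]`, `hi κ = lo κ + 2m` (`κ ∈ D`), `hi κ = lo κ` (`κ ∉ D`); its BOUNDARY `∂B` (some active coordinate extreme); the
sup-norm RADIUS `rad x = max_{κ ∈ D} |x κ − lo κ − m|` about the centre; the DISCRETE RADIAL PROJECTION `proj x ∈ ∂B`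
(`proj x κ = lo κ + m + ⌊(x κ − lo κ − m)·m / rad x⌋`) and the depth `lam x = rad x / m ∈ [0, 1]`.

Proved: `proj` fixes `∂B`, maps the box into `∂B`, and moves by at most `2m / rad y + 1` per coordinate along a lattice bond
`(x, y)`; `lam` moves by at most `1/m`; along the boundary a function with bond oscillation `≤ σ` has oscillation
`≤ σ·‖p − p'‖₁` between points of a common face or of two adjacent faces (lattice paths inside the faces).

HONEST SCOPE.  Elementary lattice geometry, `--supports stmt-QuantumFields-22542`; nothing about gauge fields, the crux, rung R3 or
any summit statement; nothing here bears on the Yang–Mills mass gap.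
-/

namespace Summit.QuantumFields.YangMills.Theorems.FlatRatioTermination.Cone

open Finset

/-- A cell of the cubical complex of side `2m` in `ℤ^d`: lower corner, active directions, half-side. [folklore] -/
structure Cell (d : ℕ) where
  /-- lower corner -/
  lo : Fin d → ℤ
  /-- active directions -/
  D : Finset (Fin d)
  /-- half of the side length -/
  m : ℕ

namespace Cell

variable {d : ℕ} (c : Cell d)

/-- The upper corner: `lo κ + 2m` in the active directions, `lo κ` otherwise. [folklore] -/
def hi : Fin d → ℤ := fun κ => if κ ∈ c.D then c.lo κ + 2 * c.m else c.lo κ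

/-- The closed integer box `[lo, hi]`. [folklore] -/
def box : Set (Fin d → ℤ) := {x | ∀ κ, c.lo κ ≤ x κ ∧ x κ ≤ c.hi κ}

/-- The boundary of the box: some ACTIVE coordinate is extreme. [folklore] -/
def bdry : Set (Fin d → ℤ) := {x | x ∈ c.box ∧ ∃ κ ∈ c.D, x κ = c.lo κ ∨ x κ = c.lo κ + 2 * c.m}

/-- Unfolding membership in the box. [folklore] -/
theorem mem_box {x : Fin d → ℤ} : x ∈ c.box ↔ ∀ κ, c.lo κ ≤ x κ ∧ x κ ≤ c.hi κ := Iff.rfl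

/-- Unfolding membership in the boundary. [folklore] -/
theorem mem_bdry {x : Fin d → ℤ} : x ∈ c.bdry ↔ x ∈ c.box ∧ ∃ κ ∈ c.D, x κ = c.lo κ ∨ x κ = c.lo κ + 2 * c.m := Iff.rfl

/-- Deviation from the centre in coordinate `κ`. [folklore] -/
def dev (x : Fin d → ℤ) (κ : Fin d) : ℤ := x κ - c.lo κ - c.m

/-- The sup-norm radius about the centre (over the active directions). [folklore] -/
def rad (x : Fin d → ℤ) : ℕ := c.D.sup fun κ => (c.dev x κ).natAbs

/-- The depth `rad x / m ∈ [0, 1]`. [folklore] -/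
noncomputable def lam (x : Fin d → ℤ) : ℝ := (c.rad x : ℝ) / c.m

/-- The discrete radial projection to the boundary (the lower corner when `rad x = 0`). [folklore] -/
noncomputable def proj (x : Fin d → ℤ) : Fin d → ℤ := fun κ =>
  if κ ∈ c.D then (if c.rad x = 0 then c.lo κ else c.lo κ + c.m + ⌊(c.dev x κ : ℝ) * c.m / c.rad x⌋) else c.lo κ

/-! ### The box -/

/-- `hi` in an active direction. [folklore] -/
@[simp] theorem hi_of_mem {κ : Fin d} (h : κ ∈ c.D) : c.hi κ = c.lo κ + 2 * c.m := by simp [hi, h]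

/-- `hi` in an inactive direction. [folklore] -/
@[simp] theorem hi_of_not_mem {κ : Fin d} (h : κ ∉ c.D) : c.hi κ = c.lo κ := by simp [hi, h]

/-- The lower corner lies in the box. [folklore] -/
theorem lo_inBox : c.lo ∈ c.box := by
  intro κ
  by_cases h : κ ∈ c.D
  · simp [h]
  · simp [h]

/-- In an inactive direction every box point sits at `lo`. [folklore] -/
theorem eq_lo_of_not_mem {x : Fin d → ℤ} (hx : x ∈ c.box) {κ : Fin d} (h : κ ∉ c.D) : x κ = c.lo κ := by
  have h1 := hx κ; rw [c.hi_of_not_mem h] at h1; omega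

/-- In the box the deviations are at most `m`. [folklore] -/
theorem abs_dev_le {x : Fin d → ℤ} (hx : x ∈ c.box) (κ : Fin d) : |c.dev x κ| ≤ c.m := by
  have h1 := hx κ
  unfold dev
  by_cases h : κ ∈ c.D
  · rw [c.hi_of_mem h] at h1; rw [abs_le]; omega
  · rw [c.hi_of_not_mem h] at h1; rw [abs_le]; omega

/-- In the box the radius is at most `m`. [folklore] -/
theorem rad_le {x : Fin d → ℤ} (hx : x ∈ c.box) : c.rad x ≤ c.m := by
  unfold rad
  refine Finset.sup_le fun κ _ => ?_
  have h := c.abs_dev_le hx κ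
  have : ((c.dev x κ).natAbs : ℤ) ≤ c.m := by rwa [Int.natCast_natAbs]
  exact_mod_cast this

/-- Each active deviation is bounded by the radius. [folklore] -/
theorem natAbs_dev_le_rad (x : Fin d → ℤ) {κ : Fin d} (h : κ ∈ c.D) : (c.dev x κ).natAbs ≤ c.rad x :=
  Finset.le_sup (f := fun κ => (c.dev x κ).natAbs) h

/-- Real form: `|dev x κ| ≤ rad x` for active `κ`. [folklore] -/
theorem abs_dev_le_rad (x : Fin d → ℤ) {κ : Fin d} (h : κ ∈ c.D) : |(c.dev x κ : ℝ)| ≤ c.rad x := by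
  have h1 := c.natAbs_dev_le_rad x h
  have h2 : (|c.dev x κ| : ℤ) ≤ c.rad x := by rw [← Int.natCast_natAbs]; exact_mod_cast h1
  have h3 : ((|c.dev x κ| : ℤ) : ℝ) ≤ ((c.rad x : ℤ) : ℝ) := by exact_mod_cast h2
  simpa [Int.cast_abs] using h3

/-- The radius is attained in some active direction. [folklore] -/
theorem exists_natAbs_dev_eq_rad (x : Fin d → ℤ) (hD : c.D.Nonempty) : ∃ κ ∈ c.D, (c.dev x κ).natAbs = c.rad x := by
  obtain ⟨κ, hκ, h⟩ := Finset.exists_mem_eq_sup c.D hD (fun κ => (c.dev x κ).natAbs)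
  exact ⟨κ, hκ, h.symm⟩

/-- A positive radius forces an active direction. [folklore] -/
theorem nonempty_of_rad_ne_zero {x : Fin d → ℤ} (h : c.rad x ≠ 0) : c.D.Nonempty := by
  rw [Finset.nonempty_iff_ne_empty]
  intro hD
  apply h
  simp [rad, hD]

/-- On the boundary the radius equals `m`. [folklore] -/
theorem rad_eq_of_onBdry {x : Fin d → ℤ} (hx : x ∈ c.bdry) : c.rad x = c.m := by
  refine le_antisymm (c.rad_le hx.1) ?_
  obtain ⟨κ, hκ, h⟩ := hx.2
  refine le_trans ?_ (c.natAbs_dev_le_rad x hκ)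
  unfold dev
  rcases h with h | h
  · rw [h]; omega
  · rw [h]; omega

/-- On the boundary the depth is `1`. [folklore] -/
theorem lam_eq_one_of_onBdry {x : Fin d → ℤ} (hx : x ∈ c.bdry) (hm : 1 ≤ c.m) : c.lam x = 1 := by
  unfold lam
  rw [c.rad_eq_of_onBdry hx]
  have : (c.m : ℝ) ≠ 0 := by exact_mod_cast (show c.m ≠ 0 by omega)
  exact div_self this

/-- The projection fixes the boundary pointwise. [folklore] -/
theorem proj_eq_self_of_onBdry {x : Fin d → ℤ} (hx : x ∈ c.bdry) (hm : 1 ≤ c.m) : c.proj x = x := by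
  have hr := c.rad_eq_of_onBdry hx
  have hm0 : c.m ≠ 0 := by omega
  funext κ
  unfold proj
  by_cases h : κ ∈ c.D
  · rw [if_pos h, if_neg (by rw [hr]; exact hm0), hr]
    have hmr : (c.m : ℝ) ≠ 0 := by exact_mod_cast hm0
    rw [mul_div_assoc, div_self hmr, mul_one, Int.floor_intCast]
    unfold dev; ring
  · rw [if_neg h]; exact (c.eq_lo_of_not_mem hx.1 h).symm

/-- The depth lies in `[0, 1]` on the box. [folklore] -/
theorem lam_nonneg (x : Fin d → ℤ) : 0 ≤ c.lam x := by unfold lam; positivity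

/-- The depth lies in `[0, 1]` on the box. [folklore] -/
theorem lam_le_one {x : Fin d → ℤ} (hx : x ∈ c.box) : c.lam x ≤ 1 := by
  unfold lam
  rcases Nat.eq_zero_or_pos c.m with h | h
  · simp [h]
  · rw [div_le_one (by exact_mod_cast h)]; exact_mod_cast c.rad_le hx

/-- When the radius vanishes the projection is the lower corner. [folklore] -/
theorem proj_of_rad_eq_zero {x : Fin d → ℤ} (h : c.rad x = 0) : c.proj x = c.lo := by
  funext κ; unfold proj; by_cases hκ : κ ∈ c.D <;> simp [hκ, h]

/-- The lower corner is a boundary point as soon as there is an active direction. [folklore] -/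
theorem lo_onBdry (hD : c.D.Nonempty) : c.lo ∈ c.bdry := by
  obtain ⟨κ, hκ⟩ := hD
  exact ⟨c.lo_inBox, κ, hκ, Or.inl rfl⟩

/-- The floor of `v·m/r` lies in `[-m, m]` when `|v| ≤ r`, `r > 0`. [folklore] -/
theorem abs_floor_le {v r : ℝ} {m : ℕ} (hr : 0 < r) (hv : |v| ≤ r) : |⌊v * m / r⌋| ≤ (m : ℤ) := by
  rw [abs_le] at hv ⊢
  have hm : (0 : ℝ) ≤ m := by positivity
  constructor
  · rw [Int.le_floor]
    push_cast
    rw [le_div_iff₀ hr]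
    nlinarith
  · have h1 : v * m / r ≤ m := by
      rw [div_le_iff₀ hr]; nlinarith
    have h2 : (⌊v * ↑m / r⌋ : ℝ) ≤ m := (Int.floor_le _).trans h1
    exact_mod_cast h2

/-- The projection maps the box into the boundary. [folklore] -/
theorem proj_onBdry (x : Fin d → ℤ) (hD : c.D.Nonempty) : c.proj x ∈ c.bdry := by
  by_cases h0 : c.rad x = 0
  · rw [c.proj_of_rad_eq_zero h0]; exact c.lo_onBdry hD
  have hr : (0 : ℝ) < c.rad x := by exact_mod_cast Nat.pos_of_ne_zero h0
  refine ⟨fun κ => ?_, ?_⟩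
  · unfold proj
    by_cases hκ : κ ∈ c.D
    · rw [if_pos hκ, if_neg h0, c.hi_of_mem hκ]
      have h := abs_floor_le (m := c.m) hr (c.abs_dev_le_rad x hκ)
      rw [abs_le] at h
      constructor <;> omega
    · rw [if_neg hκ, c.hi_of_not_mem hκ]; exact ⟨le_rfl, le_rfl⟩
  · obtain ⟨κ, hκ, hκr⟩ := c.exists_natAbs_dev_eq_rad x hD
    refine ⟨κ, hκ, ?_⟩
    unfold proj
    rw [if_pos hκ, if_neg h0]
    have hmr : (c.rad x : ℝ) ≠ 0 := hr.ne'
    rcases Int.natAbs_eq (c.dev x κ) with h | h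
    · right
      rw [hκr] at h
      have h' : (c.dev x κ : ℝ) = c.rad x := by exact_mod_cast h
      have h2 : (c.dev x κ : ℝ) * c.m / c.rad x = ((c.m : ℤ) : ℝ) := by rw [h']; field_simp; push_cast; ring
      rw [h2, Int.floor_intCast]; ring
    · left
      rw [hκr] at h
      have h' : (c.dev x κ : ℝ) = -c.rad x := by exact_mod_cast h
      have h2 : (c.dev x κ : ℝ) * c.m / c.rad x = ((-(c.m : ℤ) : ℤ) : ℝ) := by rw [h']; push_cast; field_simp
      rw [h2, Int.floor_intCast]; ring

/-! ### Lattice bonds: the projection and the depth move little -/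

/-- The deviation after a unit step. [folklore] -/
theorem dev_add_single (x : Fin d → ℤ) (ι κ : Fin d) :
    c.dev (x + Pi.single ι 1) κ = c.dev x κ + if κ = ι then 1 else 0 := by
  unfold dev
  by_cases h : κ = ι
  · subst h; simp; ring
  · simp [h]

/-- The radius changes by at most one along a lattice bond. [folklore] -/
theorem rad_step (x : Fin d → ℤ) (ι : Fin d) :
    c.rad (x + Pi.single ι 1) ≤ c.rad x + 1 ∧ c.rad x ≤ c.rad (x + Pi.single ι 1) + 1 := by
  constructor
  · refine Finset.sup_le fun κ hκ => ?_
    have h1 := c.natAbs_dev_le_rad x hκ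
    rw [c.dev_add_single]
    split_ifs <;> omega
  · refine Finset.sup_le fun κ hκ => ?_
    have h1 := c.natAbs_dev_le_rad (x + Pi.single ι 1) hκ
    rw [c.dev_add_single] at h1
    split_ifs at h1 <;> omega

/-- The depth changes by at most `1/m` along a lattice bond. [folklore] -/
theorem abs_lam_sub_lam_le (x : Fin d → ℤ) (ι : Fin d) (hm : 1 ≤ c.m) :
    |c.lam x - c.lam (x + Pi.single ι 1)| ≤ 1 / c.m := by
  have hm' : (0 : ℝ) < c.m := by exact_mod_cast hm
  obtain ⟨h1, h2⟩ := c.rad_step x ι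
  unfold lam
  rw [← sub_div, abs_div, abs_of_pos hm', div_le_div_iff_of_pos_right hm', abs_le]
  have h1' : (c.rad (x + Pi.single ι 1) : ℝ) ≤ c.rad x + 1 := by exact_mod_cast h1
  have h2' : (c.rad x : ℝ) ≤ c.rad (x + Pi.single ι 1) + 1 := by exact_mod_cast h2
  constructor <;> linarith

/-- Floors of nearby reals are nearby integers. [folklore] -/
theorem abs_floor_sub_floor_le (a b : ℝ) : |((⌊a⌋ : ℤ) : ℝ) - ⌊b⌋| ≤ |a - b| + 1 := by
  have h1 := Int.floor_le a
  have h2 := Int.lt_floor_add_one a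
  have h3 := Int.floor_le b
  have h4 := Int.lt_floor_add_one b
  rw [abs_le]
  constructor
  · have := neg_abs_le (a - b); linarith
  · have := le_abs_self (a - b); linarith

/-- Along a lattice bond `(x, y)` with both radii positive, each coordinate of the projection moves by at most `2m / rad y + 1`.
[folklore] -/
theorem abs_proj_sub_proj_le (x : Fin d → ℤ) (ι κ : Fin d) (hx : c.rad x ≠ 0) (hy : c.rad (x + Pi.single ι 1) ≠ 0) :
    |(c.proj x κ : ℝ) - c.proj (x + Pi.single ι 1) κ| ≤ 2 * c.m / c.rad (x + Pi.single ι 1) + 1 := by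
  set y := x + Pi.single ι 1 with hydef
  have hrx : (0 : ℝ) < c.rad x := by exact_mod_cast Nat.pos_of_ne_zero hx
  have hry : (0 : ℝ) < c.rad y := by exact_mod_cast Nat.pos_of_ne_zero hy
  have hm : (0 : ℝ) ≤ c.m := by positivity
  by_cases hκ : κ ∈ c.D
  · unfold proj
    rw [if_pos hκ, if_pos hκ, if_neg hx, if_neg hy]
    push_cast
    have e1 : ((c.lo κ : ℝ) + c.m + ⌊(c.dev x κ : ℝ) * c.m / c.rad x⌋) - (c.lo κ + c.m + ⌊(c.dev y κ : ℝ) * c.m / c.rad y⌋)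
        = (⌊(c.dev x κ : ℝ) * c.m / c.rad x⌋ : ℝ) - ⌊(c.dev y κ : ℝ) * c.m / c.rad y⌋ := by ring
    rw [e1]
    refine (abs_floor_sub_floor_le _ _).trans ?_
    -- `|a − b| ≤ 2m / rad y`
    have hDx : |(c.dev x κ : ℝ)| ≤ c.rad x := c.abs_dev_le_rad x hκ
    have hDy : (c.dev y κ : ℝ) = c.dev x κ + if κ = ι then 1 else 0 := by
      rw [hydef, c.dev_add_single]; push_cast; split_ifs <;> simp
    have hε : |(c.dev y κ : ℝ) - c.dev x κ| ≤ 1 := by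
      rw [hDy]; split_ifs <;> simp
    obtain ⟨hr1, hr2⟩ := c.rad_step x ι
    have hτ : |(c.rad y : ℝ) - c.rad x| ≤ 1 := by
      rw [abs_le]
      have hr1' : (c.rad y : ℝ) ≤ c.rad x + 1 := by exact_mod_cast hr1
      have hr2' : (c.rad x : ℝ) ≤ c.rad y + 1 := by exact_mod_cast hr2
      constructor <;> linarith
    have key : |(c.dev x κ : ℝ) * c.m / c.rad x - (c.dev y κ : ℝ) * c.m / c.rad y| ≤ 2 * c.m / c.rad y := by
      rw [show (2 : ℝ) * c.m / c.rad y = c.m * (2 / c.rad y) by ring]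
      have e2 : (c.dev x κ : ℝ) * c.m / c.rad x - (c.dev y κ : ℝ) * c.m / c.rad y
          = c.m * ((c.dev x κ * (c.rad y - c.rad x) - (c.dev y κ - c.dev x κ) * c.rad x) / (c.rad x * c.rad y)) := by
        field_simp; ring
      rw [e2, abs_mul, abs_of_nonneg hm, abs_div, abs_of_pos (mul_pos hrx hry)]
      refine mul_le_mul_of_nonneg_left ?_ hm
      rw [div_le_div_iff₀ (mul_pos hrx hry) hry]
      have hnum : |(c.dev x κ : ℝ) * (c.rad y - c.rad x) - (c.dev y κ - c.dev x κ) * c.rad x| ≤ 2 * c.rad x := by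
        refine (abs_sub _ _).trans ?_
        rw [abs_mul, abs_mul, abs_of_pos hrx]
        nlinarith [abs_nonneg (c.dev x κ : ℝ), abs_nonneg ((c.rad y : ℝ) - c.rad x),
          abs_nonneg ((c.dev y κ : ℝ) - c.dev x κ)]
      nlinarith
    linarith
  · unfold proj
    rw [if_neg hκ, if_neg hκ, sub_self, abs_zero]
    positivity

/-- The `ℓ¹` length of an integer vector. [folklore] -/
def l1norm (v : Fin d → ℤ) : ℕ := ∑ ι, (v ι).natAbs

/-- The `ℓ¹` length as a real sum of absolute values. [folklore] -/
theorem cast_l1norm (v : Fin d → ℤ) : (l1norm v : ℝ) = ∑ ι, |(v ι : ℝ)| := by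
  unfold l1norm
  push_cast
  refine Finset.sum_congr rfl fun ι _ => ?_
  simp

/-- Along a lattice bond with both radii positive, the projection moves by at most `|D|·(2m / rad y + 1)` in `ℓ¹`. [folklore] -/
theorem l1_proj_sub_proj_le (x : Fin d → ℤ) (ι : Fin d) (hx : c.rad x ≠ 0) (hy : c.rad (x + Pi.single ι 1) ≠ 0) :
    (l1norm (c.proj x - c.proj (x + Pi.single ι 1)) : ℝ)
      ≤ c.D.card * (2 * c.m / c.rad (x + Pi.single ι 1) + 1) := by
  rw [cast_l1norm]
  have hzero : ∀ κ ∈ (Finset.univ : Finset (Fin d)), κ ∉ c.D →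
      |(((c.proj x - c.proj (x + Pi.single ι 1)) κ : ℤ) : ℝ)| = 0 := by
    intro κ _ hκ
    simp [proj, hκ]
  rw [← Finset.sum_subset (Finset.subset_univ c.D) hzero]
  have hb : ∀ κ ∈ c.D, |(((c.proj x - c.proj (x + Pi.single ι 1)) κ : ℤ) : ℝ)|
      ≤ 2 * c.m / c.rad (x + Pi.single ι 1) + 1 := by
    intro κ _
    push_cast [Pi.sub_apply]
    exact c.abs_proj_sub_proj_le x ι κ hx hy
  calc ∑ κ ∈ c.D, |(((c.proj x - c.proj (x + Pi.single ι 1)) κ : ℤ) : ℝ)|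
      ≤ ∑ κ ∈ c.D, (2 * (c.m : ℝ) / c.rad (x + Pi.single ι 1) + 1) := Finset.sum_le_sum hb
    _ = c.D.card * (2 * c.m / c.rad (x + Pi.single ι 1) + 1) := by rw [Finset.sum_const, nsmul_eq_mul]

end Cell

end Summit.QuantumFields.YangMills.Theorems.FlatRatioTermination.Cone
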